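import Summits.CriticalPhenomena.PercolationContinuityZ3.Theorems.SahiAEOpenBandBounds

/-!
# THE BAND THEOREM IN EVERY DIMENSION: everywhere versions of a.e.-supermodular functions on open bands

Support file of the Sahi cell (`prim-sahi`, typer seat, generation 25; `--supports stmt-CriticalPhenomena-4575`).
One small definition (`openBandVersion`), theorems otherwise; no named facts, no sorries.

Seventh file of the structure theorem for densities with zeros in every dimension; it assembles files 1–6.  Let
`U ⊆ ℝ^ι` (`ι` finite) be an **open band** — an open sublattice whose axis-parallel sections are order-convex
(`IsOpenBand`) — and `φ : ℝ^ι → ℝ` measurable and supermodular on Lebesgue-almost every pair OF `U`.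

* `exists_measurable_supermodular_version_of_ae_openBand` — THE BAND THEOREM, additive form: `φ` has a Borel version
  `ψ` (`= φ` a.e. on `U`) with `ψ(x) + ψ(y) ≤ ψ(x ∧ y) + ψ(x ∨ y)` for ALL `x, y ∈ U`.  No bounds are assumed.
* `exists_measurable_tp2_version_of_ae_openBand` — multiplicative form (densities with zeros): a measurable
  `f : ℝ^ι → [0,∞]`, TP₂ on almost every pair of `ℝ^ι`, a.e. positive and finite on `U` and a.e. zero off `U`, has
  a Borel version `F`, positive and finite on `U`, zero off `U`, MTP₂ at EVERY pair of `ℝ^ι`.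

In the plane these are `Plane.exists_measurable_supermodular_version_of_ae_band` and
`Plane.exists_measurable_tp2_version_of_ae_band` of generation 24 (every planar band is an open band), whose proof —
gluing boxed orthant versions over arm boxes after a fibrewise trivialisation of their modular corrections — does not
extend to `d ≥ 3` (an incomparable pair of a band need not span a box inside it, and supermodularity across the
components of disconnected sections is a global constraint).  THE NEW PROOF: choose a dense generic family of base
points `c_k ∈ U` (`BandFamily`); subtract from `φ` the MODULAR Borel function `G(x) = Σᵢ φ(c_{k(i,xᵢ)}; i := xᵢ)`
read off, in each direction, the first family line passing robustly through `U` at the given height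
(`lineSum`); the lower-corner essential envelope `E` of the corrected density `q = 𝟙_U e^{φ − G}` is MTP₂ at EVERY
pair unconditionally (`cornerEssSup_mul_le`, generation 23) and dominates `q` a.e. (`ae_le_cornerEnvelope`); and
`E ≤ q` a.e. on `U` with `0 < E < ∞` on `U` because from the lower-left of every point `q` is an everywhere-monotone
envelope factor times one-dimensional factors of bounded variation (`SahiAEOpenBandBounds.lean`).  The version is

  `openBandVersion = 𝟙_U · E · e^{G}`,

MTP₂ at every pair since `e^G` is modular and `U` a sublattice.  No sorries, no new axioms.
-/

noncomputable section

namespace Summit.CriticalPhenomena.PercolationContinuityZ3.Theorems.SahiAEFourFunctions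

open MeasureTheory Set Filter Topology Function Metric
open scoped ENNReal NNReal

variable {ι : Type*} [Fintype ι] [DecidableEq ι]

/-! ### The version -/

/-- **The open-band version** `𝟙_U · cornerEnvelope(corrDensity) · exp(lineSum)`. [this work] -/
def openBandVersion (U : Set (ι → ℝ)) (φ : (ι → ℝ) → ℝ) (c : ℕ → ι → ℝ) : (ι → ℝ) → ℝ≥0∞ :=
  U.indicator fun x => cornerEnvelope (corrDensity U φ c) x * ENNReal.ofReal (Real.exp (lineSum U φ c x))

/-- The open-band version is measurable. [folklore] -/
theorem measurable_openBandVersion {U : Set (ι → ℝ)} (hUo : IsOpen U) {φ : (ι → ℝ) → ℝ} (hφ : Measurable φ)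
    (c : ℕ → ι → ℝ) : Measurable (openBandVersion U φ c) :=
  ((measurable_cornerEnvelope (measurable_corrDensity hUo hφ c)).mul
    (ENNReal.measurable_ofReal.comp (Real.measurable_exp.comp (measurable_lineSum hUo hφ c)))).indicator
    hUo.measurableSet

/-- The open-band version vanishes off `U`. [folklore] -/
theorem openBandVersion_of_not_mem {U : Set (ι → ℝ)} {φ : (ι → ℝ) → ℝ} {c : ℕ → ι → ℝ} {x : ι → ℝ}
    (hx : x ∉ U) : openBandVersion U φ c x = 0 := Set.indicator_of_notMem hx _

/-- The open-band version on `U`. [folklore] -/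
theorem openBandVersion_of_mem {U : Set (ι → ℝ)} {φ : (ι → ℝ) → ℝ} {c : ℕ → ι → ℝ} {x : ι → ℝ} (hx : x ∈ U) :
    openBandVersion U φ c x = cornerEnvelope (corrDensity U φ c) x * ENNReal.ofReal (Real.exp (lineSum U φ c x)) :=
  Set.indicator_of_mem hx _

/-- **The open-band version is positive and finite on `U`.** [this work] -/
theorem openBandVersion_ne_zero_ne_top {U : Set (ι → ℝ)} (hU : IsOpenBand U) {φ : (ι → ℝ) → ℝ} (hφ : Measurable φ)
    (hsmU : ∀ᵐ q ∂(volume : Measure (ι → ℝ)).prod volume,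
      q.1 ∈ U → q.2 ∈ U → φ q.1 + φ q.2 ≤ φ (q.1 ⊓ q.2) + φ (q.1 ⊔ q.2))
    {c : ℕ → ι → ℝ} (hF : BandFamily U φ c) {x : ι → ℝ} (hx : x ∈ U) :
    openBandVersion U φ c x ≠ 0 ∧ openBandVersion U φ c x ≠ ∞ := by
  rw [openBandVersion_of_mem hx]
  exact ⟨mul_ne_zero (cornerEnvelope_corrDensity_ne_zero hU hφ hsmU hF hx) (ENNReal.ofReal_pos.2 (Real.exp_pos _)).ne',
    ENNReal.mul_ne_top (cornerEnvelope_corrDensity_ne_top hU hφ hsmU hF hx) ENNReal.ofReal_ne_top⟩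

/-- **The open-band version is a version of `e^φ` on `U`.** [this work] -/
theorem ae_openBandVersion_eq {U : Set (ι → ℝ)} (hU : IsOpenBand U) {φ : (ι → ℝ) → ℝ} (hφ : Measurable φ)
    (hsmU : ∀ᵐ q ∂(volume : Measure (ι → ℝ)).prod volume,
      q.1 ∈ U → q.2 ∈ U → φ q.1 + φ q.2 ≤ φ (q.1 ⊓ q.2) + φ (q.1 ⊔ q.2))
    {c : ℕ → ι → ℝ} (hF : BandFamily U φ c) :
    ∀ᵐ x ∂(volume : Measure (ι → ℝ)), x ∈ U → openBandVersion U φ c x = ENNReal.ofReal (Real.exp (φ x)) := by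
  filter_upwards [ae_cornerEnvelope_corrDensity_eq hU hφ hsmU hF] with x hx hxU
  rw [openBandVersion_of_mem hxU, hx hxU, corrDensity_of_mem hxU, ← ENNReal.ofReal_mul (Real.exp_pos _).le,
    ← Real.exp_add, sub_add_cancel]

/-- **The open-band version is MTP₂ at every pair of `ℝ^ι`** (the envelope is MTP₂ at every pair of `U` by
`cornerEnvelope_mul_le_of_ne_top`, `exp(lineSum)` is modular, `U` is a sublattice, and the version vanishes off
`U`). [this work] -/
theorem openBandVersion_mul_le {U : Set (ι → ℝ)} (hU : IsOpenBand U) {φ : (ι → ℝ) → ℝ} (hφ : Measurable φ)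
    (hsmU : ∀ᵐ q ∂(volume : Measure (ι → ℝ)).prod volume,
      q.1 ∈ U → q.2 ∈ U → φ q.1 + φ q.2 ≤ φ (q.1 ⊓ q.2) + φ (q.1 ⊔ q.2))
    {c : ℕ → ι → ℝ} (hF : BandFamily U φ c) (x y : ι → ℝ) :
    openBandVersion U φ c x * openBandVersion U φ c y ≤
      openBandVersion U φ c (x ⊓ y) * openBandVersion U φ c (x ⊔ y) := by
  by_cases hx : x ∈ U
  · by_cases hy : y ∈ U
    · have hxy : x ⊓ y ∈ U := hU.inf_mem x hx y hy
      have hxy' : x ⊔ y ∈ U := hU.sup_mem x hx y hy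
      set E := cornerEnvelope (corrDensity U φ c) with hE
      have hEm : E x * E y ≤ E (x ⊓ y) * E (x ⊔ y) :=
        cornerEnvelope_mul_le_of_ne_top (measurable_corrDensity hU.isOpen hφ c) (ae_mtp2_corrDensity hU hsmU c)
          (cornerEnvelope_corrDensity_ne_top hU hφ hsmU hF hx) (cornerEnvelope_corrDensity_ne_top hU hφ hsmU hF hy)
          (cornerEnvelope_corrDensity_ne_top hU hφ hsmU hF hxy) (cornerEnvelope_corrDensity_ne_top hU hφ hsmU hF hxy')
      have hW : ENNReal.ofReal (Real.exp (lineSum U φ c x)) * ENNReal.ofReal (Real.exp (lineSum U φ c y)) =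
          ENNReal.ofReal (Real.exp (lineSum U φ c (x ⊓ y))) * ENNReal.ofReal (Real.exp (lineSum U φ c (x ⊔ y))) := by
        rw [← ENNReal.ofReal_mul (Real.exp_pos _).le, ← ENNReal.ofReal_mul (Real.exp_pos _).le, ← Real.exp_add,
          ← Real.exp_add, lineSum_modular]
      rw [openBandVersion_of_mem hx, openBandVersion_of_mem hy, openBandVersion_of_mem hxy,
        openBandVersion_of_mem hxy']
      calc E x * ENNReal.ofReal (Real.exp (lineSum U φ c x)) * (E y * ENNReal.ofReal (Real.exp (lineSum U φ c y)))
          = (E x * E y) * (ENNReal.ofReal (Real.exp (lineSum U φ c x)) *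
              ENNReal.ofReal (Real.exp (lineSum U φ c y))) := by ring
        _ ≤ (E (x ⊓ y) * E (x ⊔ y)) * (ENNReal.ofReal (Real.exp (lineSum U φ c (x ⊓ y))) *
              ENNReal.ofReal (Real.exp (lineSum U φ c (x ⊔ y)))) := by rw [hW]; exact mul_le_mul' hEm le_rfl
        _ = E (x ⊓ y) * ENNReal.ofReal (Real.exp (lineSum U φ c (x ⊓ y))) *
              (E (x ⊔ y) * ENNReal.ofReal (Real.exp (lineSum U φ c (x ⊔ y)))) := by ring
    · rw [openBandVersion_of_not_mem hy, mul_zero]; exact zero_le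
  · rw [openBandVersion_of_not_mem hx, zero_mul]; exact zero_le

/-! ### The band theorem in every dimension -/

/-- **THE BAND THEOREM IN EVERY DIMENSION, additive form.**  On an open band `U ⊆ ℝ^ι` (an open sublattice with
order-convex axis-parallel sections), a measurable `φ` supermodular on almost every pair of `U` has a Borel version
supermodular at EVERY pair of `U`; no bounds are assumed. [this work] -/
theorem exists_measurable_supermodular_version_of_ae_openBand {U : Set (ι → ℝ)} (hU : IsOpenBand U)
    (φ : (ι → ℝ) → ℝ) (hφ : Measurable φ)
    (hsmU : ∀ᵐ q ∂(volume : Measure (ι → ℝ)).prod volume,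
      q.1 ∈ U → q.2 ∈ U → φ q.1 + φ q.2 ≤ φ (q.1 ⊓ q.2) + φ (q.1 ⊔ q.2)) :
    ∃ ψ : (ι → ℝ) → ℝ, Measurable ψ ∧ (∀ᵐ x ∂(volume : Measure (ι → ℝ)), x ∈ U → ψ x = φ x) ∧
      ∀ x ∈ U, ∀ y ∈ U, ψ x + ψ y ≤ ψ (x ⊓ y) + ψ (x ⊔ y) := by
  classical
  rcases Set.eq_empty_or_nonempty U with hUe | hne
  · exact ⟨φ, hφ, Eventually.of_forall fun _ _ => rfl, fun x hx => by simp [hUe] at hx⟩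
  obtain ⟨c, hF⟩ := exists_bandFamily hU.isOpen hne hφ hsmU
  have hVm : Measurable (openBandVersion U φ c) := measurable_openBandVersion hU.isOpen hφ c
  have hVpos : ∀ x ∈ U, 0 < (openBandVersion U φ c x).toReal := fun x hx =>
    ENNReal.toReal_pos (openBandVersion_ne_zero_ne_top hU hφ hsmU hF hx).1
      (openBandVersion_ne_zero_ne_top hU hφ hsmU hF hx).2
  refine ⟨fun x => Real.log (openBandVersion U φ c x).toReal,
    Real.measurable_log.comp (ENNReal.measurable_toReal.comp hVm), ?_, fun x hx y hy => ?_⟩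
  · filter_upwards [ae_openBandVersion_eq hU hφ hsmU hF] with x hx hxU
    rw [hx hxU, ENNReal.toReal_ofReal (Real.exp_pos _).le, Real.log_exp]
  · have hxy : x ⊓ y ∈ U := hU.inf_mem x hx y hy
    have hxy' : x ⊔ y ∈ U := hU.sup_mem x hx y hy
    have h := openBandVersion_mul_le hU hφ hsmU hF x y
    have hT : ∀ {z}, z ∈ U → openBandVersion U φ c z ≠ ∞ := fun hz =>
      (openBandVersion_ne_zero_ne_top hU hφ hsmU hF hz).2
    have hL : (openBandVersion U φ c x * openBandVersion U φ c y).toReal ≤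
        (openBandVersion U φ c (x ⊓ y) * openBandVersion U φ c (x ⊔ y)).toReal :=
      ENNReal.toReal_mono (ENNReal.mul_ne_top (hT hxy) (hT hxy')) h
    rw [ENNReal.toReal_mul, ENNReal.toReal_mul] at hL
    rw [← Real.log_mul (hVpos x hx).ne' (hVpos y hy).ne', ← Real.log_mul (hVpos _ hxy).ne' (hVpos _ hxy').ne']
    exact Real.log_le_log (mul_pos (hVpos x hx) (hVpos y hy)) hL

/-- **THE BAND THEOREM IN EVERY DIMENSION, multiplicative form (densities with zeros).**  Let `U ⊆ ℝ^ι` be an open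
band and `f : ℝ^ι → [0, ∞]` measurable, TP₂ on almost every pair of `ℝ^ι`, almost everywhere positive and finite on
`U` and almost everywhere zero off `U`.  Then `f` has a Borel version `F`, positive and finite on `U`, zero off `U`,
which is TP₂ at EVERY pair of `ℝ^ι`. [this work] -/
theorem exists_measurable_tp2_version_of_ae_openBand {U : Set (ι → ℝ)} (hU : IsOpenBand U)
    (f : (ι → ℝ) → ℝ≥0∞) (hf : Measurable f)
    (hpos : ∀ᵐ x ∂(volume : Measure (ι → ℝ)), x ∈ U → f x ≠ 0 ∧ f x ≠ ∞)
    (hzero : ∀ᵐ x ∂(volume : Measure (ι → ℝ)), x ∉ U → f x = 0)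
    (hMTP : ∀ᵐ q ∂(volume : Measure (ι → ℝ)).prod volume, f q.1 * f q.2 ≤ f (q.1 ⊓ q.2) * f (q.1 ⊔ q.2)) :
    ∃ F : (ι → ℝ) → ℝ≥0∞, Measurable F ∧ (∀ x ∈ U, F x ≠ 0 ∧ F x ≠ ∞) ∧ (∀ x ∉ U, F x = 0) ∧
      F =ᵐ[(volume : Measure (ι → ℝ))] f ∧ ∀ x y, F x * F y ≤ F (x ⊓ y) * F (x ⊔ y) := by
  set φ : (ι → ℝ) → ℝ := fun x => Real.log (f x).toReal with hφdef
  have hφ : Measurable φ := Real.measurable_log.comp (ENNReal.measurable_toReal.comp hf)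
  -- the four points of almost every pair avoid the bad set
  have hG : ∀ᵐ u ∂Measure.pi (fun _ : ι => (volume : Measure ℝ)), u ∈ {x | x ∈ U → f x ≠ 0 ∧ f x ≠ ∞} := by
    rw [← volume_pi]; exact hpos
  have hG2 := ae_prod_mem_inf_sup_of_sigmaFinite (fun _ : ι => (volume : Measure ℝ)) hG
  rw [← volume_pi] at hG2
  have hsmU : ∀ᵐ q ∂(volume : Measure (ι → ℝ)).prod volume,
      q.1 ∈ U → q.2 ∈ U → φ q.1 + φ q.2 ≤ φ (q.1 ⊓ q.2) + φ (q.1 ⊔ q.2) := by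
    filter_upwards [hMTP, hG2] with q hq hGq h1 h2
    have hi : q.1 ⊓ q.2 ∈ U := hU.inf_mem _ h1 _ h2
    have hs : q.1 ⊔ q.2 ∈ U := hU.sup_mem _ h1 _ h2
    have f1 := hGq.1.1 h1; have f2 := hGq.1.2 h2; have f3 := hGq.2.1 hi; have f4 := hGq.2.2 hs
    have hpos' : ∀ {z}, f z ≠ 0 ∧ f z ≠ ∞ → 0 < (f z).toReal := fun h => ENNReal.toReal_pos h.1 h.2
    have hL : (f q.1 * f q.2).toReal ≤ (f (q.1 ⊓ q.2) * f (q.1 ⊔ q.2)).toReal :=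
      ENNReal.toReal_mono (ENNReal.mul_ne_top f3.2 f4.2) hq
    rw [ENNReal.toReal_mul, ENNReal.toReal_mul] at hL
    simp only [hφdef]
    rw [← Real.log_mul (hpos' f1).ne' (hpos' f2).ne', ← Real.log_mul (hpos' f3).ne' (hpos' f4).ne']
    exact Real.log_le_log (mul_pos (hpos' f1) (hpos' f2)) hL
  obtain ⟨ψ, hψm, hψae, hψsm⟩ := exists_measurable_supermodular_version_of_ae_openBand hU φ hφ hsmU
  have mU : MeasurableSet U := hU.isOpen.measurableSet
  refine ⟨U.indicator fun x => ENNReal.ofReal (Real.exp (ψ x)),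
    (ENNReal.measurable_ofReal.comp (Real.measurable_exp.comp hψm)).indicator mU, fun x hx => ?_, fun x hx => ?_,
    ?_, fun x y => ?_⟩
  · rw [Set.indicator_of_mem hx]
    exact ⟨(ENNReal.ofReal_pos.2 (Real.exp_pos _)).ne', ENNReal.ofReal_ne_top⟩
  · exact Set.indicator_of_notMem hx _
  · filter_upwards [hψae, hpos, hzero] with x hx hxp hxz
    by_cases hxU : x ∈ U
    · rw [Set.indicator_of_mem hxU, hx hxU]
      simp only [hφdef]
      rw [Real.exp_log (ENNReal.toReal_pos (hxp hxU).1 (hxp hxU).2), ENNReal.ofReal_toReal (hxp hxU).2]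
    · rw [Set.indicator_of_notMem hxU, hxz hxU]
  · by_cases hx : x ∈ U
    · by_cases hy : y ∈ U
      · rw [Set.indicator_of_mem hx, Set.indicator_of_mem hy, Set.indicator_of_mem (hU.inf_mem x hx y hy),
          Set.indicator_of_mem (hU.sup_mem x hx y hy), ← ENNReal.ofReal_mul (Real.exp_pos _).le,
          ← ENNReal.ofReal_mul (Real.exp_pos _).le, ← Real.exp_add, ← Real.exp_add]
        exact ENNReal.ofReal_le_ofReal (Real.exp_le_exp.2 (hψsm x hx y hy))
      · rw [Set.indicator_of_notMem hy, mul_zero]; exact zero_le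
    · rw [Set.indicator_of_notMem hx, zero_mul]; exact zero_le

end Summit.CriticalPhenomena.PercolationContinuityZ3.Theorems.SahiAEFourFunctions
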